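import Summits.Langlands.Langlands.Theses.EvenSkinnerWilesMirror
import Literature.NumberTheory.Automorphic.TunnellOctahedralGlobal

/-!
# Birth skeleton of the piece X₄ `OddnessAlongMirror` (child of crux stmt-Langlands-15309 `BianchiMirrorParity`)

Two stubs, both genuine lemmas of size M and both provable now: (A) the automorphic-to-Galois Frobenius bookkeeping
(`r ↔ π₀ ↝ π ↔ ρ|_K` gives equal Frobenius characteristic polynomials of `r|_K` and `ρ|_K` at cofinitely many `w`),
(B) the Galois lemma (equal Frobenius characteristic polynomials a.e., `ρ|_K` irreducible, `r` odd ⇒ `ρ` odd: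
Chebotarev + Brauer–Nesbitt + Clifford at index two); `OddnessAlongMirror_of` composes them.
-/

set_option linter.dupNamespace false

namespace Summit.Langlands.Langlands.Cruxes.BianchiMirrorParity.OddnessAlongMirrorBirth

open Filter
open Literature.NumberTheory.Automorphic Literature.NumberTheory.GaloisRepresentations

/-- STUB (A) (new lemma, M): along `r ↔ π₀` (Satake–Frobenius a.e. over `ℚ`), `π₀ ↝ π` (weak base change,
`t_{π,w} = t_{π₀,v}^{f(w|v)}` a.e.) and `π ↔ ρ|_K` (Satake–Frobenius a.e. over `K`), the restrictions `r|_K` and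
`ρ|_K` are unramified with THE SAME Frobenius characteristic polynomial at cofinitely many places `w` of `K`
(`FramedGaloisRep.hasFrobCharpolyAt_restrictField_fin_two`: `charpoly r|_K(Frob_w) = charpoly r(Frob_v^f)`;
Satake uniqueness `hasSatakeParamAt_unique_holds`; `eventually_under`). [folklore] -/
theorem stub_frobCharpoly_agree : ∀ (p : ℕ) [Fact p.Prime] (K : Type) [Field K] [NumberField K], NumberField.IsTotallyComplex K → Module.finrank ℚ K = 2 → ∀ (hcpt : Literature.NumberTheory.Automorphic.isCompact_glFiniteIntegralLevel 2 K) (hℚ : Literature.NumberTheory.Automorphic.isCompact_glFiniteIntegralLevel 2 ℚ) (ι : PadicAlgCl p ≃+* ℂ) (ρ r : Literature.NumberTheory.GaloisRepresentations.FramedGaloisRep ℚ (PadicAlgCl p) 2) (π : Literature.NumberTheory.Automorphic.CuspidalAutomorphicRepData 2 K hcpt) (π₀ : Literature.NumberTheory.Automorphic.CuspidalAutomorphicRepData 2 ℚ hℚ), (∀ᶠ w in cofinite, Summit.Langlands.SatakeFrobCompatibleAt ι π.1 (ρ.restrictField K) w) → Literature.NumberTheory.Automorphic.IsWeakBaseChangeLiftAE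 π₀.1 π.1 → (∀ᶠ v in cofinite, Summit.Langlands.SatakeFrobCompatibleAt ι π₀.1 r v) → (∀ᶠ w in cofinite, ∃ P : Polynomial (PadicAlgCl p), (ρ.restrictField K).IsUnramifiedAt w ∧ (r.restrictField K).IsUnramifiedAt w ∧ (ρ.restrictField K).HasFrobCharpolyAt w P ∧ (r.restrictField K).HasFrobCharpolyAt w P) := by
  sorry

/-- STUB (B) (new lemma, M): if `ρ|_K` is irreducible (`[K : ℚ] = 2`), `r` is odd, and `r|_K`, `ρ|_K` have equal
Frobenius characteristic polynomials at cofinitely many places, then `ρ` is odd — Chebotarev density and continuity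
give equal characteristic polynomials on `Γ_K`, Brauer–Nesbitt gives `ρ|_K ≅ (r|_K)^{ss}`, so `r|_K` is irreducible
and `ρ ≅ r ⊗ χ` with `χ` trivial on `Γ_K` (Clifford / Frobenius reciprocity at index two), whence
`det ρ(c) = det r(c) χ(c)² = -1`. [folklore] -/
theorem stub_isOdd_of_frobCharpoly_agree : ∀ (p : ℕ) [Fact p.Prime] (K : Type) [Field K] [NumberField K], Module.finrank ℚ K = 2 → ∀ (ρ r : Literature.NumberTheory.GaloisRepresentations.FramedGaloisRep ℚ (PadicAlgCl p) 2), (ρ.restrictField K).toGaloisRep.IsIrreducible → r.IsOdd → (∀ᶠ w in cofinite, ∃ P : Polynomial (PadicAlgCl p), (ρ.restrictField K).IsUnramifiedAt w ∧ (r.restrictField K).IsUnramifiedAt w ∧ (ρ.restrictField K).HasFrobCharpolyAt w P ∧ (r.restrictField K).HasFrobCharpolyAt w P) → ρ.IsOdd := by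
  sorry

/-- **COMPOSITION (no sorry): the two stubs imply X₄ `OddnessAlongMirror`.** [folklore] -/
theorem OddnessAlongMirror_of :
    (∀ (p : ℕ) [Fact p.Prime] (K : Type) [Field K] [NumberField K], NumberField.IsTotallyComplex K → Module.finrank ℚ K = 2 → ∀ (hcpt : Literature.NumberTheory.Automorphic.isCompact_glFiniteIntegralLevel 2 K) (hℚ : Literature.NumberTheory.Automorphic.isCompact_glFiniteIntegralLevel 2 ℚ) (ι : PadicAlgCl p ≃+* ℂ) (ρ r : Literature.NumberTheory.GaloisRepresentations.FramedGaloisRep ℚ (PadicAlgCl p) 2) (π : Literature.NumberTheory.Automorphic.CuspidalAutomorphicRepData 2 K hcpt) (π₀ : Literature.NumberTheory.Automorphic.CuspidalAutomorphicRepData 2 ℚ hℚ), (∀ᶠ w in cofinite, Summit.Langlands.SatakeFrobCompatibleAt ι π.1 (ρ.restrictField K) w) → Literature.NumberTheory.Automorphic.IsWeakBaseChangeLiftAE π₀.1 π.1 → (∀ᶠ v in cofinite, Summit.Langlands.SatakeFrobCompatibleAt ι π₀.1 r v) → (∀ᶠ w in cofinite, ∃ P : Polynomial (PadicAlgCl p),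 (ρ.restrictField K).IsUnramifiedAt w ∧ (r.restrictField K).IsUnramifiedAt w ∧ (ρ.restrictField K).HasFrobCharpolyAt w P ∧ (r.restrictField K).HasFrobCharpolyAt w P)) →
    (∀ (p : ℕ) [Fact p.Prime] (K : Type) [Field K] [NumberField K], Module.finrank ℚ K = 2 → ∀ (ρ r : Literature.NumberTheory.GaloisRepresentations.FramedGaloisRep ℚ (PadicAlgCl p) 2), (ρ.restrictField K).toGaloisRep.IsIrreducible → r.IsOdd → (∀ᶠ w in cofinite, ∃ P : Polynomial (PadicAlgCl p), (ρ.restrictField K).IsUnramifiedAt w ∧ (r.restrictField K).IsUnramifiedAt w ∧ (ρ.restrictField K).HasFrobCharpolyAt w P ∧ (r.restrictField K).HasFrobCharpolyAt w P) → ρ.IsOdd) →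
      (∀ (p : ℕ) [Fact p.Prime] (K : Type) [Field K] [NumberField K], NumberField.IsTotallyComplex K → Module.finrank ℚ K = 2 → ∀ (hcpt : Literature.NumberTheory.Automorphic.isCompact_glFiniteIntegralLevel 2 K) (hℚ : Literature.NumberTheory.Automorphic.isCompact_glFiniteIntegralLevel 2 ℚ) (ι : PadicAlgCl p ≃+* ℂ) (ρ r : Literature.NumberTheory.GaloisRepresentations.FramedGaloisRep ℚ (PadicAlgCl p) 2) (π : Literature.NumberTheory.Automorphic.CuspidalAutomorphicRepData 2 K hcpt) (π₀ : Literature.NumberTheory.Automorphic.CuspidalAutomorphicRepData 2 ℚ hℚ), (ρ.restrictField K).toGaloisRep.IsIrreducible → r.IsOdd → (∀ᶠ w in cofinite, Summit.Langlands.SatakeFrobCompatibleAt ι π.1 (ρ.restrictField K) w) → Literature.NumberTheory.Automorphic.IsWeakBaseChangeLiftAE π₀.1 π.1 → (∀ᶠ v in cofinite, Summit.Langlands.SatakeFrobCompatibleAt ι π₀.1 r v) → ρ.IsOdd) := by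
  intro hA hB
  intro p _ K _ _ hKc hK2 hcpt hℚ ι ρ r π π₀ hirr hrodd hπsat hBC hrsat
  exact hB p K hK2 ρ r hirr hrodd (hA p K hKc hK2 hcpt hℚ ι ρ r π π₀ hπsat hBC hrsat)

/-- X₄ from the stubs. [folklore] -/
theorem oddnessAlongMirror_of_stubs : (∀ (p : ℕ) [Fact p.Prime] (K : Type) [Field K] [NumberField K], NumberField.IsTotallyComplex K → Module.finrank ℚ K = 2 → ∀ (hcpt : Literature.NumberTheory.Automorphic.isCompact_glFiniteIntegralLevel 2 K) (hℚ : Literature.NumberTheory.Automorphic.isCompact_glFiniteIntegralLevel 2 ℚ) (ι : PadicAlgCl p ≃+* ℂ) (ρ r : Literature.NumberTheory.GaloisRepresentations.FramedGaloisRep ℚ (PadicAlgCl p) 2) (π : Literature.NumberTheory.Automorphic.CuspidalAutomorphicRepData 2 K hcpt) (π₀ : Literature.NumberTheory.Automorphic.CuspidalAutomorphicRepData 2 ℚ hℚ), (ρ.restrictField K).toGaloisRep.IsIrreducible → r.IsOdd → (∀ᶠ w in cofinite, Summit.Langlands.SatakeFrobCompatibleAt ι π.1 (ρ.restrictField K)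 w) → Literature.NumberTheory.Automorphic.IsWeakBaseChangeLiftAE π₀.1 π.1 → (∀ᶠ v in cofinite, Summit.Langlands.SatakeFrobCompatibleAt ι π₀.1 r v) → ρ.IsOdd) :=
  OddnessAlongMirror_of stub_frobCharpoly_agree stub_isOdd_of_frobCharpoly_agree

end Summit.Langlands.Langlands.Cruxes.BianchiMirrorParity.OddnessAlongMirrorBirth
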